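/-
Origin: expansion seat `planner-pub-hodgecm-mc-glue-1-g11-0`, handover #SG44 2026-08-20T16:55:47Z md5 7430e846fef6 (REPLACE; pre md5 8b35beea3d65 → new md5 7430e846fef6; 117 l.; (μ4) scope-guard rewrite of the RUN-55 installed file; family glue-1; compiled ok 0 proof-hole) (`HOME/mc/pub-hodgecm-mc-glue-1-g11/stage56/HodgeCM/Model/E2InstanceOGR9.lean`, md5 7430e846fef6, 117 lines);
landed by the second packager p2 gen 10 (p2-g10) in gate run 56 REPLACES the earlier landed copy of `HodgeCM/Model/E2InstanceOGR9.lean` (seat copy carried the packager Origin header of an earlier run (stripped)).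
-/
/-
Origin: glue-1 lane, seat `planner-pub-hodgecm-mc-glue-1-g9-0` (unit pub-hodgecm-mc-glue-1-g9), 2026-08-20 — item (TWIST-2), route (c̄)+(o) OF RECORD (lead 1-g60
RULING SUPPLEMENT 2, STATUS 2026-08-20 l.12559; guard cut model1-g10 G3 l.12580 (B)): the CANONICALLY GUARDED oriented E chain — generated from the
oriented chain `HodgeCM/Model/E2InstanceOR9.lean` (RUN-41 row) by `tools/gen_OG.py`: in the eight class-hypothesis binder groups the guard
`(NumberField.InfinitePlace.mk ι₁).embedding = ι₁ →` follows `Module.finrank ℚ c.K = 6 →`, the guard is threaded pointwise through the proof, and the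
conclusion is `Universe.PerLCanonical` (axioms-3 `Model/PerLOfCanonical`, RUN-41 row #12).  ADDITIVE LEAF; no new definition, record or cite.
-/
import Summits.HodgeConjecture.HodgeCM.Model.E2InstanceOGR8
import Summits.HodgeConjecture.HodgeCM.Model.E2InstanceR9

/-!
# E2InstanceOGR9 — guarded oriented E chain

GUARDED VARIANT (item (TWIST-2), route (c̄)+(o) of record): this module is the `O`-module of the same name-stem (RUN-41 kit
`t41-mcglue1g9.txt`) with the canonical-representative guard `(NumberField.InfinitePlace.mk ι₁).embedding = ι₁` inserted after
the class hypothesis `Module.finrank ℚ c.K = 6` of every class-hypothesis binder group and threaded pointwise (`hcan`) through the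
proof; every theorem concludes `Universe.PerLCanonical` instead of `Universe.PerL` (recovered by axioms-3's
`perL_picardCM_of_perLCanonical` in `E2InstanceOGR21AEP`).
-/

noncomputable section

open scoped TensorProduct InnerProductSpace Matrix

namespace HodgeCM

namespace Model

open HodgeCM.Universe (AdelicThetaCore AdelicThetaCore₀ SideData ThetaModel ModelAxiomsPerL)
open Literature.AlgebraicGeometry.HodgeTheory
open Literature.AlgebraicGeometry.ComplexMultiplication (Shimura1998_Thm3_isogenousPower Shimura1998_Thm2_Cor)
open Literature.NumberTheory.Automorphic.PicardCM
open Literature.NumberTheory.Transcendental (Arapura2012_Cor_15_4_6)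
open HodgeCM.CMTypeOps (inflate)
open HodgeCM.Model.SupplyResidual (ClassSupplyPackN)
open HodgeCM.Model.ThetaSpace

variable (hHD : exists_isReal_hodgeModel) (hI : hodgePQ_independent_of_hodgeModel)
  (h₁ : BallQuotientUniformised)  (h₃ : CMAbelianVarietyRealised)

/-- **ORIENTED-FAMILY twin of `perL_picardCM_r9core`** (`E2InstanceR9`): the recipe bit per complex place, `h ↦ hb L ι₁` in every binder;
proof = the source proof over the oriented predecessor. -/
theorem perLCanonical_picardCM_r9coreOG (hHR : BettiUniverse.HodgeRiemann20) (hb : ∀ L : CMField, (L →+* ℂ) → Bool)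
    (hA : Arapura2012_Cor_15_4_6)
    (W : ∀ {L : CMField} {ι₁ : L →+* ℂ} (V : HermSpace3 L ι₁) (c : SeesawCtx L), WmInput V c.D)
    (S : ∀ {L : CMField} {ι₁ : L →+* ℂ} (V : HermSpace3 L ι₁) (c : SeesawCtx L), ThetaAdelicSide V c)
    (μ : ∀ {L : CMField}, SeesawCtx L → Fin 4 → NumberField.InfinitePlace L → ℤ)
    (hBetti : ∀ {L : CMField} {ι₁ : L →+* ℂ} (V : HermSpace3 L ι₁), EmbBettiSide hHD hI h₁ h₃ V)
    (h31 : (picardCMUniverse hHD hI h₁ h₃).Fact_cmInflation)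
    (hLiu : ∀ {L : CMField} {ι₁ : L →+* ℂ} (V : HermSpace3 L ι₁) (c : SeesawCtx L),
      (thetaModelOf hHD hI h₁ h₃ (hb L ι₁) (embOf hHD hI h₁ h₃) (coverOf hHD hI h₁ h₃ hA) (wmOfInput W) (thetaOf _ (thetaClassInputOf _ (fun V c => thetaSpaceInputOf hHD hI h₁ h₃ S V c))) (d12Of μ) (d34Of μ)).GoodCtx ι₁ c → Module.finrank ℚ c.K = 6 ∧ IsNormalClosure ℚ c.K L ∧ (Module.finrank ℚ L = 24 ∨ Module.finrank ℚ L = 48) →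
      (NumberField.InfinitePlace.mk ι₁).embedding = ι₁ →
      ∀ (i : Fin 4) (Γ : Level V), ∃ (M : CMField) (k : c.K →+* M) (σ' : M →+* ℂ), σ'.comp k = c.σ ∧
        (thetaModelOf hHD hI h₁ h₃ (hb L ι₁) (embOf hHD hI h₁ h₃) (coverOf hHD hI h₁ h₃ hA) (wmOfInput W) (thetaOf _ (thetaClassInputOf _ (fun V c => thetaSpaceInputOf hHD hI h₁ h₃ S V c))) (d12Of μ) (d34Of μ)).Theta V c i Γ ⊆
          (picardCMUniverse hHD hI h₁ h₃).Uiso Γ M (inflate k (c.Ψ i)) σ')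
    (thetaSat : ∀ {L : CMField} {ι₁ : L →+* ℂ} (V : HermSpace3 L ι₁) (c : SeesawCtx L)
      (i : Fin 4) (Γ Γ' : Level V) (hle : Γ' ≤ Γ) (ω : (picardCMUniverse hHD hI h₁ h₃).CohC ((picardCMUniverse hHD hI h₁ h₃).pms L ι₁ V Γ) 1),
      ω ∈ (thetaModelOf hHD hI h₁ h₃ (hb L ι₁) (embOf hHD hI h₁ h₃) (coverOf hHD hI h₁ h₃ hA) (wmOfInput W) (thetaOf _ (thetaClassInputOf _ (fun V c => thetaSpaceInputOf hHD hI h₁ h₃ S V c))) (d12Of μ) (d34Of μ)).Theta V c i Γ →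
        (picardCMUniverse hHD hI h₁ h₃).pullC (coverOf hHD hI h₁ h₃ hA Γ Γ' (Level.Γ_mono hle)) 1 ω ∈ (thetaModelOf hHD hI h₁ h₃ (hb L ι₁) (embOf hHD hI h₁ h₃) (coverOf hHD hI h₁ h₃ hA) (wmOfInput W) (thetaOf _ (thetaClassInputOf _ (fun V c => thetaSpaceInputOf hHD hI h₁ h₃ S V c))) (d12Of μ) (d34Of μ)).Theta V c i Γ')
    (transl : ∀ {L : CMField} {ι₁ : L →+* ℂ} (V : HermSpace3 L ι₁) (c : SeesawCtx L)
      (hc : (thetaModelOf hHD hI h₁ h₃ (hb L ι₁) (embOf hHD hI h₁ h₃) (coverOf hHD hI h₁ h₃ hA) (wmOfInput W) (thetaOf _ (thetaClassInputOf _ (fun V c => thetaSpaceInputOf hHD hI h₁ h₃ S V c))) (d12Of μ) (d34Of μ)).GoodCtx ι₁ c) (hK : Module.finrank ℚ c.K = 6 ∧ IsNormalClosure ℚ c.K L ∧ (Module.finrank ℚ L = 24 ∨ Module.finrank ℚ L = 48)),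
      ∀ γ ∈ (ballOf hHD hI h₁ h₃ V c (two_lt_finrank_of_goodCtx hHD hI h₁ h₃ hc hK.1)).Δ, ∀ (i : Fin 4) (Γ : Level V) (ω : (picardCMUniverse hHD hI h₁ h₃).CohC ((picardCMUniverse hHD hI h₁ h₃).pms L ι₁ V Γ) 1),
      ω ∈ (thetaModelOf hHD hI h₁ h₃ (hb L ι₁) (embOf hHD hI h₁ h₃) (coverOf hHD hI h₁ h₃ hA) (wmOfInput W) (thetaOf _ (thetaClassInputOf _ (fun V c => thetaSpaceInputOf hHD hI h₁ h₃ S V c))) (d12Of μ) (d34Of μ)).Theta V c i Γ → ∃ (Γ' : Level V) (ω' : (picardCMUniverse hHD hI h₁ h₃).CohC ((picardCMUniverse hHD hI h₁ h₃).pms L ι₁ V Γ') 1),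
        ω' ∈ (thetaModelOf hHD hI h₁ h₃ (hb L ι₁) (embOf hHD hI h₁ h₃) (coverOf hHD hI h₁ h₃ hA) (wmOfInput W) (thetaOf _ (thetaClassInputOf _ (fun V c => thetaSpaceInputOf hHD hI h₁ h₃ S V c))) (d12Of μ) (d34Of μ)).Theta V c i Γ' ∧ (ballOf hHD hI h₁ h₃ V c (two_lt_finrank_of_goodCtx hHD hI h₁ h₃ hc hK.1)).ev Γ' ω' =
          fun x => (ballOf hHD hI h₁ h₃ V c (two_lt_finrank_of_goodCtx hHD hI h₁ h₃ hc hK.1)).J γ x *ᵥ (ballOf hHD hI h₁ h₃ V c (two_lt_finrank_of_goodCtx hHD hI h₁ h₃ hc hK.1)).ev Γ ω (γ • x))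
    (C : ∀ {L : CMField} {ι₁ : L →+* ℂ} (V : HermSpace3 L ι₁) (c : SeesawCtx L) (hV : IsAnisotropic L V.Hm),
      (thetaModelOf hHD hI h₁ h₃ (hb L ι₁) (embOf hHD hI h₁ h₃) (coverOf hHD hI h₁ h₃ hA) (wmOfInput W) (thetaOf _ (thetaClassInputOf _ (fun V c => thetaSpaceInputOf hHD hI h₁ h₃ S V c))) (d12Of μ) (d34Of μ)).GoodCtx ι₁ c →
      Module.finrank ℚ c.K = 6 ∧ IsNormalClosure ℚ c.K L ∧ (Module.finrank ℚ L = 24 ∨ Module.finrank ℚ L = 48) →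
      (NumberField.InfinitePlace.mk ι₁).embedding = ι₁ → ∀ k : Fin 4, k = 0 ∨ k = 1 → ∀ N : ℕ, 0 < N →
        ArchKTypeData (thetaSpaceInputIn hHD hI h₁ h₃ (S V c) hV) k N)
    (hol : ∀ {L : CMField} {ι₁ : L →+* ℂ} (V : HermSpace3 L ι₁) (c : SeesawCtx L) (hV : IsAnisotropic L V.Hm)
      (hc : (thetaModelOf hHD hI h₁ h₃ (hb L ι₁) (embOf hHD hI h₁ h₃) (coverOf hHD hI h₁ h₃ hA) (wmOfInput W) (thetaOf _ (thetaClassInputOf _ (fun V c => thetaSpaceInputOf hHD hI h₁ h₃ S V c))) (d12Of μ) (d34Of μ)).GoodCtx ι₁ c)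
      (h6 : Module.finrank ℚ c.K = 6 ∧ IsNormalClosure ℚ c.K L ∧ (Module.finrank ℚ L = 24 ∨ Module.finrank ℚ L = 48)) (hcan : (NumberField.InfinitePlace.mk ι₁).embedding = ι₁) (k : Fin 4) (hk : k = 0 ∨ k = 1) (N : ℕ) (hN : 0 < N),
      ∀ f ∈ ((thetaSpaceInputIn hHD hI h₁ h₃ (S V c) hV).P k).weightFunctions,
        (C V c hV hc h6 hcan k hk N hN).toProduct.restrictedThetaForm f ∈
          ((thetaSpaceInputIn hHD hI h₁ h₃ (S V c) hV).D (C V c hV hc h6 hcan k hk N hN).Γ₀).Hol)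
    (gen12 : ∀ {L : CMField} {ι₁ : L →+* ℂ} (V : HermSpace3 L ι₁) (c : SeesawCtx L),
      (thetaModelOf hHD hI h₁ h₃ (hb L ι₁) (embOf hHD hI h₁ h₃) (coverOf hHD hI h₁ h₃ hA) (wmOfInput W) (thetaOf _ (thetaClassInputOf _ (fun V c => thetaSpaceInputOf hHD hI h₁ h₃ S V c))) (d12Of μ) (d34Of μ)).GoodCtx ι₁ c → Module.finrank ℚ c.K = 6 ∧ IsNormalClosure ℚ c.K L ∧ (Module.finrank ℚ L = 24 ∨ Module.finrank ℚ L = 48) →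
      (NumberField.InfinitePlace.mk ι₁).embedding = ι₁ →
      Nonempty ((thetaModelOf hHD hI h₁ h₃ (hb L ι₁) (embOf hHD hI h₁ h₃) (coverOf hHD hI h₁ h₃ hA) (wmOfInput W) (thetaOf _ (thetaClassInputOf _ (fun V c => thetaSpaceInputOf hHD hI h₁ h₃ S V c))) (d12Of μ) (d34Of μ)).Gen12FunBridge V c))
    (real34 : ∀ {L : CMField} {ι₁ : L →+* ℂ} (V : HermSpace3 L ι₁) (c : SeesawCtx L),
      (thetaModelOf hHD hI h₁ h₃ (hb L ι₁) (embOf hHD hI h₁ h₃) (coverOf hHD hI h₁ h₃ hA) (wmOfInput W) (thetaOf _ (thetaClassInputOf _ (fun V c => thetaSpaceInputOf hHD hI h₁ h₃ S V c))) (d12Of μ) (d34Of μ)).GoodCtx ι₁ c → Module.finrank ℚ c.K = 6 ∧ IsNormalClosure ℚ c.K L ∧ (Module.finrank ℚ L = 24 ∨ Module.finrank ℚ L = 48) →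
      (NumberField.InfinitePlace.mk ι₁).embedding = ι₁ →
      Nonempty ((thetaModelOf hHD hI h₁ h₃ (hb L ι₁) (embOf hHD hI h₁ h₃) (coverOf hHD hI h₁ h₃ hA) (wmOfInput W) (thetaOf _ (thetaClassInputOf _ (fun V c => thetaSpaceInputOf hHD hI h₁ h₃ S V c))) (d12Of μ) (d34Of μ)).Real34FunBridge V c))
    (hyp12 : ∀ {L : CMField} {ι₁ : L →+* ℂ} (V : HermSpace3 L ι₁) (c : SeesawCtx L),
      (thetaModelOf hHD hI h₁ h₃ (hb L ι₁) (embOf hHD hI h₁ h₃) (coverOf hHD hI h₁ h₃ hA) (wmOfInput W) (thetaOf _ (thetaClassInputOf _ (fun V c => thetaSpaceInputOf hHD hI h₁ h₃ S V c))) (d12Of μ) (d34Of μ)).GoodCtx ι₁ c → Module.finrank ℚ c.K = 6 ∧ IsNormalClosure ℚ c.K L ∧ (Module.finrank ℚ L = 24 ∨ Module.finrank ℚ L = 48) →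
      (NumberField.InfinitePlace.mk ι₁).embedding = ι₁ →
      Nonempty (((coreOf _ (embOf hHD hI h₁ h₃) (coverOf hHD hI h₁ h₃ hA) (wmOfInput W) (thetaOf _ (thetaClassInputOf _ (fun V c => thetaSpaceInputOf hHD hI h₁ h₃ S V c)))).toCore (hb L ι₁)).HypSmoothCore12
        (((coreOf _ (embOf hHD hI h₁ h₃) (coverOf hHD hI h₁ h₃ hA) (wmOfInput W) (thetaOf _ (thetaClassInputOf _ (fun V c => thetaSpaceInputOf hHD hI h₁ h₃ S V c)))).toCore (hb L ι₁)).side12 (d12Of μ)) (((coreOf _ (embOf hHD hI h₁ h₃) (coverOf hHD hI h₁ h₃ hA) (wmOfInput W) (thetaOf _ (thetaClassInputOf _ (fun V c => thetaSpaceInputOf hHD hI h₁ h₃ S V c)))).toCore (hb L ι₁)).side34 (d34Of μ))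
        ((((coreOf _ (embOf hHD hI h₁ h₃) (coverOf hHD hI h₁ h₃ hA) (wmOfInput W) (thetaOf _ (thetaClassInputOf _ (fun V c => thetaSpaceInputOf hHD hI h₁ h₃ S V c)))).toCore (hb L ι₁)).analyticKM (((coreOf _ (embOf hHD hI h₁ h₃) (coverOf hHD hI h₁ h₃ hA) (wmOfInput W) (thetaOf _ (thetaClassInputOf _ (fun V c => thetaSpaceInputOf hHD hI h₁ h₃ S V c)))).toCore (hb L ι₁)).side12 (d12Of μ))
          (((coreOf _ (embOf hHD hI h₁ h₃) (coverOf hHD hI h₁ h₃ hA) (wmOfInput W) (thetaOf _ (thetaClassInputOf _ (fun V c => thetaSpaceInputOf hHD hI h₁ h₃ S V c)))).toCore (hb L ι₁)).side34 (d34Of μ))).toAnalytic) V c (ℓ := linOfInput W V c)))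
    (hyp34 : ∀ {L : CMField} {ι₁ : L →+* ℂ} (V : HermSpace3 L ι₁) (c : SeesawCtx L),
      (thetaModelOf hHD hI h₁ h₃ (hb L ι₁) (embOf hHD hI h₁ h₃) (coverOf hHD hI h₁ h₃ hA) (wmOfInput W) (thetaOf _ (thetaClassInputOf _ (fun V c => thetaSpaceInputOf hHD hI h₁ h₃ S V c))) (d12Of μ) (d34Of μ)).GoodCtx ι₁ c → Module.finrank ℚ c.K = 6 ∧ IsNormalClosure ℚ c.K L ∧ (Module.finrank ℚ L = 24 ∨ Module.finrank ℚ L = 48) →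
      (NumberField.InfinitePlace.mk ι₁).embedding = ι₁ →
      Nonempty (((coreOf _ (embOf hHD hI h₁ h₃) (coverOf hHD hI h₁ h₃ hA) (wmOfInput W) (thetaOf _ (thetaClassInputOf _ (fun V c => thetaSpaceInputOf hHD hI h₁ h₃ S V c)))).toCore (hb L ι₁)).HypSmoothCore34
        (((coreOf _ (embOf hHD hI h₁ h₃) (coverOf hHD hI h₁ h₃ hA) (wmOfInput W) (thetaOf _ (thetaClassInputOf _ (fun V c => thetaSpaceInputOf hHD hI h₁ h₃ S V c)))).toCore (hb L ι₁)).side12 (d12Of μ)) (((coreOf _ (embOf hHD hI h₁ h₃) (coverOf hHD hI h₁ h₃ hA) (wmOfInput W) (thetaOf _ (thetaClassInputOf _ (fun V c => thetaSpaceInputOf hHD hI h₁ h₃ S V c)))).toCore (hb L ι₁)).side34 (d34Of μ))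
        ((((coreOf _ (embOf hHD hI h₁ h₃) (coverOf hHD hI h₁ h₃ hA) (wmOfInput W) (thetaOf _ (thetaClassInputOf _ (fun V c => thetaSpaceInputOf hHD hI h₁ h₃ S V c)))).toCore (hb L ι₁)).analyticKM (((coreOf _ (embOf hHD hI h₁ h₃) (coverOf hHD hI h₁ h₃ hA) (wmOfInput W) (thetaOf _ (thetaClassInputOf _ (fun V c => thetaSpaceInputOf hHD hI h₁ h₃ S V c)))).toCore (hb L ι₁)).side12 (d12Of μ))
          (((coreOf _ (embOf hHD hI h₁ h₃) (coverOf hHD hI h₁ h₃ hA) (wmOfInput W) (thetaOf _ (thetaClassInputOf _ (fun V c => thetaSpaceInputOf hHD hI h₁ h₃ S V c)))).toCore (hb L ι₁)).side34 (d34Of μ))).toAnalytic) V c (ℓ := linOfInput W V c))) :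
     (picardCMUniverse hHD hI h₁ h₃).PerLCanonical :=
  perLCanonical_picardCM_r8coreOG hHD hI h₁ h₃ hHR hb hA W (fun {L} {ι₁} V c => thetaSpaceInputOf hHD hI h₁ h₃ S V c) μ hBetti h31
    hLiu thetaSat transl
    (fun {L} {ι₁} V c hc h6 hcan k hk N hN => Classical.choice (by
      have hV := isAnisotropic_of_goodCtx V hc h6.1
      show Nonempty (SupplySituationAt (thetaSpaceInputOf hHD hI h₁ h₃ S V c) k N)
      rw [thetaSpaceInputOf_of_isAnisotropic hHD hI h₁ h₃ S V c hV]
      exact ⟨(C V c hV hc h6 hcan k hk N hN).toSupplySituationAt (hol V c hV hc h6 hcan k hk N hN)⟩))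
    gen12 real34 hyp12 hyp34

end Model

end HodgeCM

end
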